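import Literature.NumberTheory.EllipticCurves.IwasawaSelmerControlExactCountProofs
import Literature.NumberTheory.EllipticCurves.IwasawaEulerCharRankZeroProofs
import Literature.NumberTheory.EllipticCurves.IwasawaSelmerTorsionLevelZeroProofs
import HarnessLib

/-!
# Greenberg's Theorem 4.1 reduced to its local/global index lemmas (Lemmas 4.2 + 4.3 assembled)

Sibling proof file of `Literature.NumberTheory.EllipticCurves.IwasawaLeadingTerm` (named fact
`Schneider1985_order_charGenerator`, BMS Thm. 1.7; statement file untouched). Greenberg proves the
rank-`0` case of the Perrin-Riou–Schneider formula (LNM 1716, Thm. 4.1, p. 102 of the held copy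
`book:coatesnd-arithmetic-theory-elliptic-curves`: "`f_E(0) ∼ (∏_{v bad} c_v^{(p)})
(∏_{v∣p} |Ẽ_v(f_v)_p|²) |Sel_E(F)_p| / |E(F)_p|²`"; = Coates–Schneider–Sujatha 2003, p. 203, Case 1)
"by a series of lemmas" 4.2, 4.3, 4.4, 4.7 (p. 107: "The following lemma [4.7], together with lemmas
4.2–4.4, implies theorem 4.1"). Lemmas 4.2 and 4.3 are tree theorems
(`IwasawaEulerCharRankZeroProofs`, `IwasawaSelmerControlExactCountProofs` with
`IwasawaSelmerControlKernelCardProofs`); this file multiplies them out, for an elliptic curve over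
a number field `K`, ANY `ℤ_p`-extension `K_∞/K` with topological generator `γ`, and any
Pontryagin-dual datum `D` (`X = X(E/K_∞)` finitely generated torsion, `char(X) = (f)`):

* `WeierstrassCurve.natCard_selmerInfty_inf_layerInvariants_zero_eq`: the bridge
  **`#Sel_∞^{Γ_K} = #Sel_∞^γ`** between the invariants of the control theorem at level `0`
  (`Sel_∞ ⊓ layerInvariants 0`) and `H⁰ = endInvariants (conj_γ - 1)` of the Euler-characteristic
  files (`mem_layerInvariants_zero_of_conjH1_eq`);
* `WeierstrassCurve.natCard_fixedBy_layerSubgroup_zero_eq`: at level `0` the fixed points are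
  `E[p^∞]^{Γ_K}` (`= E(K)[p^∞]`, "`E(F)_p`");
* `WeierstrassCurve.SelmerDualData.constantCoeff_charGenerator_mul_natCard_coinvariants_mul_natCard_fixedPoints`
  (**Thm. 4.1 modulo Lemmas 4.4 and 4.7**): if `E(K_∞)[p^∞]` and `Sel_∞^γ` are finite, then
  **`f(0) · #H¹(Γ, Sel_∞) · #E[p^∞]^{Γ_K} = u · #Sel_{p^∞}(E/K) · #ker g_0`**, `u ∈ ℤ_pˣ`,
  where `ker g_0 = A_0/Sel_0` (`KerG`) and `Sel_{p^∞}(E/K) = W.selmerGroupPInfty p`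
  (`= Sel_{p^∞}(E/K_0) = selmerLayer κ 0`, `natCard_selmerLayer_zero_eq`).

* `WeierstrassCurve.SelmerDualData.constantCoeff_charGenerator_mul_natCard_of_finite_selmerGroup`
  (**the same from Greenberg's own hypotheses**): if `Sel_{p^∞}(E/K)`, `ker g_0` and `E(K_∞)[p^∞]`
  are finite, then `X` is finitely generated torsion (Mazur's Thm. 1.4 at level `0`,
  `isFG_and_isTorsion_of_finite_coker_zero` with `coker s_0` a quotient of `ker g_0`,
  `kerGToCoker_surjective`), `Sel_∞^γ` is finite, and for `char(X) = (f)` the displayed identity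
  holds. In Greenberg's setting (good ordinary reduction above `p`, cyclotomic `K_∞`, `Sel_E(F)_p`
  finite) the finiteness of `ker g_0 ⊆ ker r_0` is part of Lemma 4.4.

What remains for Thm. 4.1 itself is exactly Greenberg's `|ker(g)| = |ker(r)| |(Sel_∞)_Γ| / |E(F)_p|`
(Lemma 4.7: Cassels' `P_E(F)/G_E(F) ≅ E(F)_p^∨` by Poitou–Tate, and Lemma 4.6) and
`|ker(r)| ∼ ∏ c_v^{(p)} ∏_{v∣p} |Ẽ_v(f_v)_p|²` (Lemma 4.4: the local Lemmas 3.3–3.4), which cancel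
`#H¹(Γ, Sel_∞) = #(Sel_∞)_Γ` and square `#E(F)_p`; neither is in the tree. Everything here is
proved; no named fact is introduced.

## References

* [GreenbergLNM1716] R. Greenberg, *Iwasawa theory for elliptic curves*, LNM 1716 (1999), §4:
  Thm. 4.1 and Lemma 4.2 (p. 102), Lemma 4.3 (p. 103), Lemma 4.4 (p. 104), Lemmas 4.6–4.7
  (pp. 105–108).
* [CoatesSchneiderSujatha2003] J. Coates, P. Schneider, R. Sujatha, Doc. Math. Extra Vol. Kato
  (2003), p. 203 (Case 1).
-/

noncomputable section

open scoped Classical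

open Literature.NumberTheory.EllipticCurves Literature.NumberTheory.EllipticCurves.IwasawaAlgebra
  Literature.NumberTheory.EllipticCurves.IwasawaDual

universe u

namespace WeierstrassCurve

variable {K : Type u} [Field K] [NumberField K] (W : WeierstrassCurve K) {p : ℕ} [Fact p.Prime]
  (κ : ZpExtension K p) {γ : Field.absoluteGaloisGroup K}

/-- **`Sel_∞^{Γ_K} ≃ Sel_∞^γ`** for a topological generator `γ`: the invariants of the control
theorem at level `0` (`Sel_∞ ⊓ layerInvariants 0`, classes fixed by `conj_σ` for all
`σ ∈ κ⁻¹(p⁰ℤ_p) = Γ_K`) and the `γ`-invariants `endInvariants (conj_γ - 1)` of the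
Euler-characteristic map have the same elements (`mem_layerInvariants_zero_of_conjH1_eq`: a class
fixed by `conj_γ` is fixed by the closed subgroup generated by `γ` and `ker κ`, which is `Γ_K`).
Greenberg, LNM 1716, §1 p. 60 (`T = γ - 1`) and §3 p. 86. [folklore] -/
def selmerInftyInfLayerInvariantsZeroEquiv (hγ : κ.IsTopGenerator γ) :
    ↥(W.selmerInfty κ ⊓ W.layerInvariants κ 0) ≃ ↥(endInvariants (W.conjSelmerInfty κ γ - 1)) where
  toFun x := ⟨⟨(x : W.subgroupH1 p κ.kerSubgroup), x.2.1⟩,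
    (W.mem_endInvariants_conjSelmerInfty_iff κ γ _).mpr
      ((W.mem_layerInvariants_iff κ 0 (x : W.subgroupH1 p κ.kerSubgroup)).mp x.2.2 γ
        (by rw [ZpExtension.layerSubgroup_zero]; trivial))⟩
  invFun s := ⟨((s : W.selmerInfty κ) : W.subgroupH1 p κ.kerSubgroup),
    ⟨(s : W.selmerInfty κ).2, W.mem_layerInvariants_zero_of_conjH1_eq κ hγ
      ((W.mem_endInvariants_conjSelmerInfty_iff κ γ (s : W.selmerInfty κ)).mp s.2)⟩⟩
  left_inv x := rfl
  right_inv s := rfl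

/-- **`#Sel_∞^{Γ_K} = #Sel_∞^γ`** (`selmerInftyInfLayerInvariantsZeroEquiv`). [folklore] -/
theorem natCard_selmerInfty_inf_layerInvariants_zero_eq (hγ : κ.IsTopGenerator γ) :
    Nat.card ↥(W.selmerInfty κ ⊓ W.layerInvariants κ 0) =
      Nat.card ↥(endInvariants (W.conjSelmerInfty κ γ - 1)) :=
  Nat.card_congr (W.selmerInftyInfLayerInvariantsZeroEquiv κ hγ)

omit [NumberField K] in
/-- At level `0` (`κ⁻¹(p⁰ℤ_p) = Γ_K`, `layerSubgroup_zero`) the points of `E[p^∞]` fixed by the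
layer subgroup are the `Γ_K`-fixed points `E[p^∞]^{Γ_K}` (`= E(K)[p^∞]` by Galois descent,
Greenberg's "`E(F)_p`"). [folklore] -/
theorem natCard_fixedBy_layerSubgroup_zero_eq :
    Nat.card {m : geomPrimaryTorsion W p | ∀ σ ∈ κ.layerSubgroup 0, σ • m = m} =
      Nat.card (MulAction.fixedPoints (Field.absoluteGaloisGroup K) (geomPrimaryTorsion W p)) := by
  refine Nat.card_congr (Equiv.setCongr ?_)
  ext m
  simp only [Set.mem_setOf_eq, MulAction.mem_fixedPoints, ZpExtension.layerSubgroup_zero,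
    Subgroup.mem_top, forall_const]

/-- **`#Sel_{p^∞}(E/K_0) = #Sel_{p^∞}(E/K)`**: the Selmer group of the `0`-th layer
(`selmerLayer κ 0 = selmerGroupOver p (κ⁻¹(p⁰ℤ_p))`, and `κ⁻¹(p⁰ℤ_p) = Γ_K`, `layerSubgroup_zero`) is
the `p^∞`-Selmer group of `E/K` of file `Selmer` (`selmerGroupOver_top_holds`; same argument as
`nonempty_selmerLayer_zero_addEquiv` of `SelmerCorankControlRatProofs`). Greenberg, LNM 1716, §1
(p. 60, `F_0 = F`). [folklore] -/
theorem natCard_selmerLayer_zero_eq :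
    Nat.card ↥(W.selmerLayer κ 0) = Nat.card ↥(W.selmerGroupPInfty p) := by
  obtain ⟨e⟩ := W.selmerGroupOver_top_holds p
  have key : ∀ (H : Subgroup (Field.absoluteGaloisGroup K)) [H.Normal], H = ⊤ →
      Nat.card ↥(W.selmerGroupOver p H) = Nat.card ↥(W.selmerGroupPInfty p) := by
    rintro H _ rfl
    exact Nat.card_congr e.toEquiv
  exact key (κ.layerSubgroup 0) κ.layerSubgroup_zero

variable {κ} in
/-- **Greenberg's Theorem 4.1 reduced to Lemmas 4.4 and 4.7** (LNM 1716, pp. 102–108). Let `E/K` be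
an elliptic curve over a number field, `K_∞/K` any `ℤ_p`-extension with topological generator `γ`,
`D` a Pontryagin-dual datum with `X = X(E/K_∞)` finitely generated torsion and `char(X) = (f)`.
Assume `B = E(K_∞)[p^∞]` finite and `H⁰ = Sel_∞^γ` finite. Then `H¹ = (Sel_∞)_γ` is finite,
`f(0) ≠ 0`, and
**`f(0) · #(Sel_∞)_γ · #E[p^∞]^{Γ_K} = u · #Sel_{p^∞}(E/K) · #ker g_0`** for a unit `u ∈ ℤ_pˣ`:
Lemma 4.2 (`f(0) · #H¹ = u · #H⁰`, `SelmerDualData.constantCoeff_charGenerator_mul_natCard`) times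
Lemma 4.3 at `n = 0` with `|ker(h)| = |E(F)_p|` substituted
(`natCard_selmerInvariants_mul_natCard_fixedPoints`: `#H⁰ · #E[p^∞]^{Γ_K} = #Sel_0 · #ker g_0`),
through the bridges `#Sel_∞^{Γ_K} = #Sel_∞^γ`, `layerSubgroup 0 = Γ_K` and
`#Sel_{p^∞}(E/K_0) = #Sel_{p^∞}(E/K)` (`natCard_selmerLayer_zero_eq`). Printed continuation
(not formalised): `|ker(g)| = |ker(r)| |(Sel_∞)_Γ|/|E(F)_p|` (Lemma 4.7) and
`|ker(r)| ∼ ∏ c_v^{(p)} ∏_{v∣p} |Ẽ_v(f_v)_p|²` (Lemma 4.4) turn this into Thm. 4.1.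
[cite: GreenbergLNM1716, §4 Thm. 4.1 (proof, pp. 102–108)] -/
theorem SelmerDualData.constantCoeff_charGenerator_mul_natCard_coinvariants_mul_natCard_fixedPoints
    (D : W.SelmerDualData κ γ) (hγ : κ.IsTopGenerator γ) [Module.Finite (IwasawaAlgebra p) D.X]
    (hX : Module.IsTorsion (IwasawaAlgebra p) D.X) (f : IwasawaAlgebra p)
    (hf : Module.charIdeal (IwasawaAlgebra p) D.X = Ideal.span {f})
    [Finite (FixedPoints.addSubgroup κ.kerSubgroup (geomPrimaryTorsion W p))]
    (hfin : Finite (endInvariants (W.conjSelmerInfty κ γ - 1))) :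
    Finite (EndCoinvariants (W.conjSelmerInfty κ γ - 1)) ∧ PowerSeries.constantCoeff f ≠ 0 ∧
      ∃ u : ℤ_[p]ˣ,
        PowerSeries.constantCoeff f *
            (Nat.card (EndCoinvariants (W.conjSelmerInfty κ γ - 1)) : ℤ_[p]) *
            Nat.card (MulAction.fixedPoints (Field.absoluteGaloisGroup K) (geomPrimaryTorsion W p)) =
          u * Nat.card ↥(W.selmerGroupPInfty p) * Nat.card (W.KerG κ 0) := by
  obtain ⟨hH1, -, hf0, u, hu⟩ := D.constantCoeff_charGenerator_mul_natCard W hγ hX f hf hfin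
  refine ⟨hH1, hf0, u, ?_⟩
  have h43 := W.natCard_selmerInvariants_mul_natCard_fixedPoints κ 0
  rw [W.natCard_selmerInfty_inf_layerInvariants_zero_eq κ hγ,
    W.natCard_fixedBy_layerSubgroup_zero_eq κ, W.natCard_selmerLayer_zero_eq κ] at h43
  have h43' : (Nat.card ↥(endInvariants (W.conjSelmerInfty κ γ - 1)) : ℤ_[p]) *
      Nat.card (MulAction.fixedPoints (Field.absoluteGaloisGroup K) (geomPrimaryTorsion W p)) =
        (Nat.card ↥(W.selmerGroupPInfty p) : ℤ_[p]) * Nat.card (W.KerG κ 0) := by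
    exact_mod_cast h43
  rw [hu, mul_assoc, h43', mul_assoc]

variable {κ} in
/-- **Greenberg's Theorem 4.1 reduced to Lemmas 4.4 and 4.7, from Greenberg's own hypotheses.**
Let `E/K` be an elliptic curve over a number field, `K_∞/K` any `ℤ_p`-extension with topological
generator `γ`, `D` any Pontryagin-dual datum of `Sel_{p^∞}(E/K_∞)`. Assume that `Sel_{p^∞}(E/K)`
is finite ("Assume also that `Sel_E(F)_p` is finite", Thm. 4.1), that `ker g_0 = A_0/Sel_0` is finite
(in Greenberg's setting a consequence of the local Lemmas 3.3–3.4, cf. Lemma 4.4, `ker g ⊆ ker r`)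
and that `E(K_∞)[p^∞]` is finite. Then: `coker s_0`, a quotient of `ker g_0`
(`kerGToCoker_surjective`), is finite; `X = X(E/K_∞)` is finitely generated and `Λ`-torsion (Mazur's
Thm. 1.4 at level `0`: `isFG_and_isTorsion_of_finite_coker_zero`; "By theorem 1.4, `Sel_E(F_∞)_p` is
then `Λ`-cotorsion", p. 102); `Sel_∞^γ ≃ Sel_∞^{Γ_K}` is finite
(`finite_selmerInfty_inf_layerInvariants_zero`); and for a generator `f` of `char(X)`: `(Sel_∞)_γ` is
finite, `f(0) ≠ 0` ("Hence `T ∤ f_E(T)` and so `f_E(0) ≠ 0`", p. 102) and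
**`f(0) · #(Sel_∞)_γ · #E[p^∞]^{Γ_K} = u · #Sel_{p^∞}(E/K) · #ker g_0`**, `u ∈ ℤ_pˣ`
(`constantCoeff_charGenerator_mul_natCard_coinvariants_mul_natCard_fixedPoints`).
[cite: GreenbergLNM1716, §4 Thm. 4.1 (proof, pp. 102–108)] -/
theorem SelmerDualData.constantCoeff_charGenerator_mul_natCard_of_finite_selmerGroup
    (D : W.SelmerDualData κ γ) (hγ : κ.IsTopGenerator γ) (hSel : Finite ↥(W.selmerGroupPInfty p))
    (hg : Finite (W.KerG κ 0))
    [Finite (FixedPoints.addSubgroup κ.kerSubgroup (geomPrimaryTorsion W p))]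
    (f : IwasawaAlgebra p) (hf : Module.charIdeal (IwasawaAlgebra p) D.X = Ideal.span {f}) :
    Module.Finite (IwasawaAlgebra p) D.X ∧ Module.IsTorsion (IwasawaAlgebra p) D.X ∧
      Finite ↥(endInvariants (W.conjSelmerInfty κ γ - 1)) ∧
      Finite (EndCoinvariants (W.conjSelmerInfty κ γ - 1)) ∧ PowerSeries.constantCoeff f ≠ 0 ∧
      ∃ u : ℤ_[p]ˣ,
        PowerSeries.constantCoeff f *
            (Nat.card (EndCoinvariants (W.conjSelmerInfty κ γ - 1)) : ℤ_[p]) *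
            Nat.card (MulAction.fixedPoints (Field.absoluteGaloisGroup K) (geomPrimaryTorsion W p)) =
          u * Nat.card ↥(W.selmerGroupPInfty p) * Nat.card (W.KerG κ 0) := by
  haveI := hg
  have hquot : Finite (W.CokerS κ 0) := Finite.of_surjective _ (W.kerGToCoker_surjective κ 0)
  have hinv : Finite ↥(W.selmerInfty κ ⊓ W.layerInvariants κ 0) :=
    W.finite_selmerInfty_inf_layerInvariants_zero κ hSel hquot
  obtain ⟨hFG, hX⟩ := D.isFG_and_isTorsion_of_finite_coker_zero hγ hSel hquot
  haveI : Module.Finite (IwasawaAlgebra p) D.X := hFG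
  have hfin : Finite ↥(endInvariants (W.conjSelmerInfty κ γ - 1)) :=
    Finite.of_equiv _ (W.selmerInftyInfLayerInvariantsZeroEquiv κ hγ)
  exact ⟨hFG, hX, hfin,
    D.constantCoeff_charGenerator_mul_natCard_coinvariants_mul_natCard_fixedPoints W hγ hX f hf hfin⟩

end WeierstrassCurve
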